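import Literature.AlgebraicGeometry.Resolution.ValuedFunctionFields
import Literature.AlgebraicGeometry.Resolution.RegularLocalRings
import Literature.AlgebraicGeometry.Resolution.SeparatingTranscendenceBasis
import Mathlib.RingTheory.Valuation.Integral
import Mathlib.RingTheory.Localization.Away.Basic
import Mathlib.RingTheory.Smooth.Locus
import Mathlib.RingTheory.LocalProperties.IntegrallyClosed
import Mathlib.RingTheory.FinitePresentation
import Mathlib.FieldTheory.PurelyInseparable.PerfectClosure
import HarnessLib

/-!
# Valued function fields inside an ambient valued field: elementary lemmas

Topic: `Literature/AlgebraicGeometry/Resolution`. Mathlib-level glue for the assembly of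
Knaf–Kuhlmann 2009, Thm. 1.2 (`KnafKuhlmann2009_Thm12`, `SmoothUniformization.lean`) and of the
named fact `KnafKuhlmann2009` (`LocalUniformization.lean`) from the ingredients of its printed
proof (vendored separately as named facts, `FiniteExtensionUniformization.lean` of this topic),
in the ambient rendering of
`ValuedFunctionFields.lean`: one valued field `(Ω, V)`, "fields" are subfields of `Ω`. Everything
here is [folklore]; nothing is specific to the Knaf–Kuhlmann papers except the vocabulary
(`FGOver`, `resField`, `IsAbhyankarPlace`, `IsSmoothlyUniformizableIn`, …).

## Content

* Fraction fields and generators of subrings of `Ω`; changing the presentation of a base field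
  (subfield versus intermediate field `K(s)`) in `IsAlgebraic` / `IsSeparable` /
  `AlgebraicIndependent` statements.
* `separablyGeneratedOver_of_perfectField`: a finitely generated extension of a perfect
  subfield is separably generated (Mathlib's
  `exists_isTranscendenceBasis_and_isSeparable_of_perfectField`).
* `perfectHull k`: the relative perfect closure of a subfield `k` in `Ω` (Mathlib's
  `perfectClosure`, as a `Subfield`); it lies in every valuation ring containing `k`;
  `perfectField_resField`: the residue field of a perfect `K ⊆ V` is perfect.
* Bookkeeping for `FGOver` / `FiniteOver` / `FiniteSeparableOver` /
  `FinitePurelyInseparableOver`.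
* Consequences of the data of Knaf–Kuhlmann 2009, Prop. 2.3 for the subfield `F₀ = K(x, y)`:
  `vF/vF₀` torsion, `FP|F₀P` algebraic, `P|F₀` Abhyankar, `F|F₀` separably generated.
* `IsSmoothlyUniformizableIn.of_ringEquiv`: smooth uniformizability is insensitive to replacing
  the base ring by an isomorphic one acting on `Ω` in the same way; in particular over a
  `K`-trivial valuation, `O_K = V ∩ K`-models and `K`-models agree
  (`isSmoothlyUniformizableIn_inf_iff`).
* `locAway B f`: the subalgebra `B[1/f] ⊆ Ω`; it is the localisation of `B` away from `f`, so
  smoothness passes to it; `exists_normal_smooth_model`: a model over a field, smooth at the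
  centre, may be shrunk to an everywhere (formally) smooth, normal one containing a prescribed
  finite subset of its local ring (normality from EGA IV 17.5.8 + Matsumura 19.4, taken as the
  named facts `Grothendieck1967_17_5_8`, `Matsumura1987_19_4`);
  `isSmoothlyUniformizableIn_of_tower`: a model smooth at the centre over an everywhere smooth
  finitely generated `K`-algebra is a `K`-model smooth at the centre (EGA IV 17.3.3 (ii)).
* `isIntegrallyClosed_inf`: `V ∩ E` is a normal domain for every subfield `E`.

## Sources

* H. Knaf, F.-V. Kuhlmann, *Every place admits local uniformization in a finite extension of
  the function field*, Adv. Math. 221 (2009) 428–453 = arXiv:math/0702856, §2.1, §3.1, §4.2 (the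
  shape of the lemmas is dictated by the proof of Thm. 1.2 there).
-/

noncomputable section

namespace Literature.AlgebraicGeometry.Resolution

universe u

open IsLocalRing

variable {Ω : Type u} [Field Ω]

/-! ## Fraction fields of subrings of `Ω` -/

/-- If `A ⊆ E` and every element of the subfield `E` is a quotient of elements of `A`, then `E`
is the subfield generated by `A`. [folklore] -/
theorem subfield_closure_eq_of_frac {A : Set Ω} {E : Subfield Ω} (hAE : A ⊆ E)
    (hfrac : ∀ x ∈ E, ∃ a ∈ A, ∃ b ∈ A, x = a / b) : Subfield.closure A = E := by
  refine le_antisymm (Subfield.closure_le.mpr hAE) fun x hx => ?_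
  obtain ⟨a, ha, b, hb, rfl⟩ := hfrac x hx
  exact div_mem (Subfield.subset_closure ha) (Subfield.subset_closure hb)

/-- Elements of the subfield generated by a subring `A` are quotients of elements of `A`.
[folklore] -/
theorem exists_div_of_mem_closure (A : Subring Ω) {x : Ω}
    (hx : x ∈ Subfield.closure (A : Set Ω)) : ∃ a ∈ A, ∃ b ∈ A, x = a / b := by
  obtain ⟨y, hy, z, hz, rfl⟩ := (Subfield.mem_closure_iff).mp hx
  rw [Subring.closure_eq] at hy hz
  exact ⟨y, hy, z, hz, rfl⟩

/-! ## `K`-trivial valuations: integral elements, powers -/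

/-- An element of `Ω` integral over a subring of `V` lies in `V` (valuation rings are integrally
closed). General `Subring` form of `Literature.AlgebraicGeometry.Resolution.mem_valuationSubring_of_isIntegral`
(`InseparableLocalUniformizationDescent.lean`, stated there for subalgebras); kept here because
this file is the lighter import. Librarian note: refactor — repoint
`InseparableLocalUniformizationDescent.lean` (`mem_valuationSubring_of_isIntegral`,
`mem_valuationSubring_of_pow_mem`) to this lemma and to `mem_of_pow_mem` below, so that the
topic keeps one copy. [folklore] -/
theorem mem_of_isIntegral_of_le {V : ValuationSubring Ω} {S : Subring Ω}
    (hSV : S ≤ V.toSubring) {x : Ω} (hx : IsIntegral S x) : x ∈ V := by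
  obtain ⟨f, hfm, hfx⟩ := hx
  let ι : S →+* V := Subring.inclusion hSV
  have hint : IsIntegral V x := by
    refine ⟨f.map ι, hfm.map ι, ?_⟩
    rw [Polynomial.eval₂_map]
    exact hfx
  -- `V` is the ring of integers of its valuation (cf. `integers_valuationSubring`,
  -- `Literature/NumberTheory/EllipticCurves/FunctionFieldPlaceDegreesProofs.lean`)
  have hVint : V.valuation.Integers V :=
    { hom_inj := Subtype.coe_injective
      map_le_one := fun r => V.valuation_le_one r
      exists_of_le_one := fun r hr => ⟨⟨r, (V.valuation_le_one_iff r).mp hr⟩, rfl⟩ }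
  exact (V.valuation_le_one_iff x).mp (hVint.isIntegral_iff_v_le_one.mp hint)

/-- If the subfield `K` lies in the valuation ring `V` then so does every element of `Ω`
integral over `K`. [folklore] -/
theorem mem_of_isIntegral_of_subset {V : ValuationSubring Ω} {K : Subfield Ω}
    (hKV : (K : Set Ω) ⊆ V) {x : Ω} (hx : IsIntegral K x) : x ∈ V :=
  mem_of_isIntegral_of_le (S := K.toSubring) (fun _ hy => hKV hy) hx

/-- If a power `x ^ n`, `n ≠ 0`, lies in `V` then `x ∈ V`. (`n ≠ 0` form of
`Literature.AlgebraicGeometry.Resolution.mem_valuationSubring_of_pow_mem` of `InseparableLocalUniformizationDescent.lean`,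
which assumes `0 < n`; see the librarian note on `mem_of_isIntegral_of_le`.) [folklore] -/
theorem mem_of_pow_mem {V : ValuationSubring Ω} {x : Ω} {n : ℕ} (hn : n ≠ 0)
    (hx : x ^ n ∈ V) : x ∈ V := by
  rw [← V.valuation_le_one_iff] at hx ⊢
  rw [map_pow] at hx
  exact (pow_le_one_iff hn).mp hx

/-! ## `V ∩ E` is a normal domain -/

/-- For a subfield `E`, the subring `V ∩ E` of `Ω` is integrally closed (it is a valuation ring
of `E`): its fraction field is (inside) `E`, and an element of `E` integral over `V ∩ E` is
integral over `V`, hence in `V`. [folklore] -/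
theorem isIntegrallyClosed_inf (V : ValuationSubring Ω) (E : Subfield Ω) :
    IsIntegrallyClosed ↥(V.toSubring ⊓ E.toSubring) := by
  set S : Subring Ω := V.toSubring ⊓ E.toSubring with hS
  -- every element of the fraction field of `S` is `a / b` with `a, b ∈ S`; work inside `Ω`
  refine (isIntegrallyClosed_iff_isIntegralClosure (K := FractionRing S)).mpr ?_
  refine ⟨IsFractionRing.injective S (FractionRing S), fun {x} => ⟨fun hx => ?_, ?_⟩⟩
  · -- push `x` to `Ω`
    let j : FractionRing S →ₐ[S] Ω := IsLocalization.liftAlgHom (M := nonZeroDivisors S)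
      (f := Algebra.ofId S Ω) fun y => by
        refine Ne.isUnit ?_
        have hy0 : (y : S) ≠ 0 := nonZeroDivisors.ne_zero y.2
        change ((y : S) : Ω) ≠ 0
        exact fun h => hy0 (Subtype.ext h)
    have hjx : IsIntegral S (j x) := hx.map j
    have hxV : j x ∈ V := mem_of_isIntegral_of_le (S := S) inf_le_left hjx
    -- `j x ∈ E`: `x = a / b`
    obtain ⟨a, b, hb, rfl⟩ := IsFractionRing.div_surjective (A := S) x
    have hjab : j (algebraMap S _ a / algebraMap S _ b) = (a : Ω) / (b : Ω) := by
      rw [map_div₀]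
      change j (algebraMap S (FractionRing S) a) / j (algebraMap S (FractionRing S) b) = _
      rw [j.commutes, j.commutes]
      rfl
    have hxE : j (algebraMap S _ a / algebraMap S _ b) ∈ E := by
      rw [hjab]
      exact div_mem a.2.2 b.2.2
    refine ⟨⟨j (algebraMap S _ a / algebraMap S _ b), hxV, hxE⟩, ?_⟩
    -- injectivity of `j` identifies the preimage
    have hinj : Function.Injective j := by
      refine (injective_iff_map_eq_zero _).mpr fun y hy => ?_
      obtain ⟨c, d, hd, rfl⟩ := IsFractionRing.div_surjective (A := S) y
      have : (c : Ω) / (d : Ω) = 0 := by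
        rw [map_div₀] at hy
        change j (algebraMap S (FractionRing S) c) / j (algebraMap S (FractionRing S) d) = 0 at hy
        rwa [j.commutes, j.commutes] at hy
      have hd0 : ((d : S) : Ω) ≠ 0 := fun h => nonZeroDivisors.ne_zero hd (Subtype.ext h)
      have hc0 : (c : Ω) = 0 := by simpa [hd0] using this
      have : c = 0 := Subtype.ext hc0
      simp [this]
    apply hinj
    rw [j.commutes]
    rfl
  · rintro ⟨y, rfl⟩
    exact isIntegral_algebraMap

/-! ## Changing the presentation of the base field -/

/-- If `x` is algebraic over `F₁` and `f : F₁ → F₂` is compatible with the structure maps then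
`x` is algebraic over `F₂`. A one-line wrapper (the shape used throughout this file, companion
of `isSeparable_of_ringHom_comp_eq` of `SeparatingTranscendenceBasis.lean`) around Mathlib's
`IsAlgebraic.ringHom_of_comp_eq` (with `g := RingHom.id E`). [folklore] -/
theorem isAlgebraic_of_ringHom_comp_eq {F₁ F₂ E : Type*} [Field F₁] [Field F₂] [Ring E]
    [Algebra F₁ E] [Algebra F₂ E] (f : F₁ →+* F₂)
    (hf : (algebraMap F₂ E).comp f = algebraMap F₁ E) {x : E} (h : IsAlgebraic F₁ x) :
    IsAlgebraic F₂ x :=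
  h.ringHom_of_comp_eq f (RingHom.id E) f.injective (by ext a; exact (RingHom.congr_fun hf a :))

/-- Algebraicity over a subfield persists over any larger subfield. [folklore] -/
theorem isAlgebraic_of_subfield_le {L : Type*} [Field L] {M M' : Subfield L} (h : M ≤ M')
    {x : L} (hx : IsAlgebraic M x) : IsAlgebraic M' x :=
  isAlgebraic_of_ringHom_comp_eq (Subfield.inclusion h) (RingHom.ext fun _ => rfl) hx

/-- Separability over a subfield persists over any larger subfield. [folklore] -/
theorem isSeparable_of_subfield_le {L : Type*} [Field L] {M M' : Subfield L} (h : M ≤ M')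
    {x : L} (hx : IsSeparable M x) : IsSeparable M' x :=
  isSeparable_of_ringHom_comp_eq (Subfield.inclusion h) (RingHom.ext fun _ => rfl) hx

/-- For a subfield `K ⊆ Ω`, the range of `algebraMap K Ω` is `K`. [folklore] -/
theorem range_algebraMap_subfield (K : Subfield Ω) : Set.range (algebraMap K Ω) = (K : Set Ω) :=
  Subtype.range_coe

/-- `K(s)` as an intermediate field over `↥K` has underlying subfield `Subfield.closure (K ∪ s)`.
[folklore] -/
theorem coe_adjoin_subfield (K : Subfield Ω) (s : Set Ω) :
    ((IntermediateField.adjoin K s : IntermediateField K Ω) : Set Ω) =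
      (Subfield.closure ((K : Set Ω) ∪ s) : Set Ω) := by
  have := IntermediateField.adjoin_toSubfield (F := K) (E := Ω) (S := s)
  rw [range_algebraMap_subfield] at this
  rw [← this]
  rfl

/-- Membership version of `coe_adjoin_subfield`. [folklore] -/
theorem mem_adjoin_subfield_iff (K : Subfield Ω) (s : Set Ω) (x : Ω) :
    x ∈ (IntermediateField.adjoin K s : IntermediateField K Ω) ↔
      x ∈ Subfield.closure ((K : Set Ω) ∪ s) := by
  rw [← SetLike.mem_coe, coe_adjoin_subfield]
  rfl

/-- Algebraicity over `K(s)` as an intermediate field and over the subfield `closure (K ∪ s)`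
agree (the two presentations of the same subset of `Ω` are related by `Subfield.inclusion`).
[folklore] -/
theorem isAlgebraic_closure_iff (K : Subfield Ω) (s : Set Ω) (x : Ω) :
    IsAlgebraic (Subfield.closure ((K : Set Ω) ∪ s)) x ↔
      IsAlgebraic (IntermediateField.adjoin K s) x :=
  ⟨isAlgebraic_of_ringHom_comp_eq
      (Subfield.inclusion (show Subfield.closure ((K : Set Ω) ∪ s) ≤
          (IntermediateField.adjoin K s).toSubfield from
        fun y hy => (mem_adjoin_subfield_iff K s y).mpr hy)) (RingHom.ext fun _ => rfl),
    isAlgebraic_of_ringHom_comp_eq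
      (Subfield.inclusion (show (IntermediateField.adjoin K s).toSubfield ≤
          Subfield.closure ((K : Set Ω) ∪ s) from
        fun y hy => (mem_adjoin_subfield_iff K s y).mp hy)) (RingHom.ext fun _ => rfl)⟩

/-- Separability over `K(s)` as an intermediate field and over the subfield `closure (K ∪ s)`
agree. [folklore] -/
theorem isSeparable_closure_iff (K : Subfield Ω) (s : Set Ω) (x : Ω) :
    IsSeparable (Subfield.closure ((K : Set Ω) ∪ s)) x ↔
      IsSeparable (IntermediateField.adjoin K s) x :=
  ⟨isSeparable_of_ringHom_comp_eq
      (Subfield.inclusion (show Subfield.closure ((K : Set Ω) ∪ s) ≤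
          (IntermediateField.adjoin K s).toSubfield from
        fun y hy => (mem_adjoin_subfield_iff K s y).mpr hy)) (RingHom.ext fun _ => rfl),
    isSeparable_of_ringHom_comp_eq
      (Subfield.inclusion (show (IntermediateField.adjoin K s).toSubfield ≤
          Subfield.closure ((K : Set Ω) ∪ s) from
        fun y hy => (mem_adjoin_subfield_iff K s y).mp hy)) (RingHom.ext fun _ => rfl)⟩

/-- Elements of `K(s)`, `s` a set of algebraic elements, are algebraic over `K`. [folklore] -/
theorem isAlgebraic_of_mem_closure {K : Subfield Ω} {s : Set Ω} (hs : ∀ x ∈ s, IsAlgebraic K x)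
    {z : Ω} (hz : z ∈ Subfield.closure ((K : Set Ω) ∪ s)) : IsAlgebraic K z := by
  rw [← mem_adjoin_subfield_iff] at hz
  haveI := IntermediateField.isAlgebraic_adjoin (K := K) (S := s) fun x hx => (hs x hx).isIntegral
  have := Algebra.IsAlgebraic.isAlgebraic (R := K) (⟨z, hz⟩ : IntermediateField.adjoin K s)
  exact IntermediateField.isAlgebraic_iff.mp this

/-- Elements of `K(s)`, `s` a set of separable elements, are separable over `K`. [folklore] -/
theorem isSeparable_of_mem_closure {K : Subfield Ω} {s : Set Ω} (hs : ∀ x ∈ s, IsSeparable K x)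
    {z : Ω} (hz : z ∈ Subfield.closure ((K : Set Ω) ∪ s)) : IsSeparable K z := by
  rw [← mem_adjoin_subfield_iff] at hz
  haveI := (IntermediateField.isSeparable_adjoin_iff_isSeparable K Ω (S := s)).mpr hs
  have h1 := Algebra.IsSeparable.isSeparable K (⟨z, hz⟩ : IntermediateField.adjoin K s)
  have hmin := minpoly.algebraMap_eq (A := K)
    (algebraMap (IntermediateField.adjoin K s) Ω).injective (⟨z, hz⟩ : IntermediateField.adjoin K s)
  have hz' : algebraMap (IntermediateField.adjoin K s) Ω ⟨z, hz⟩ = z := rfl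
  rw [hz'] at hmin
  change (minpoly K z).Separable
  rw [hmin]
  exact h1

/-- If every element of the subfield `F ⊇ K` is algebraic over `K` and `z` is algebraic over
`F`, then `z` is algebraic over `K`. [folklore] -/
theorem isAlgebraic_trans_subfield {K F : Subfield Ω} (hKF : K ≤ F)
    (hF : ∀ w ∈ F, IsAlgebraic K w) {z : Ω} (hz : IsAlgebraic F z) : IsAlgebraic K z := by
  let F' : IntermediateField K Ω := F.toIntermediateField fun c => hKF c.2
  haveI : Algebra.IsAlgebraic K F' :=
    ⟨fun w => IntermediateField.isAlgebraic_iff.mpr (hF w.1 w.2)⟩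
  have hz' : IsAlgebraic F' z :=
    isAlgebraic_of_ringHom_comp_eq (F₁ := F) (F₂ := F')
      { toFun := fun w => ⟨w.1, w.2⟩
        map_one' := rfl
        map_mul' := fun _ _ => rfl
        map_zero' := rfl
        map_add' := fun _ _ => rfl } (RingHom.ext fun _ => rfl) hz
  exact (isIntegral_trans (R := K) z hz'.isIntegral).isAlgebraic

/-- Same, with the lower base an intermediate field `K(s)` and `F` a subfield containing it.
[folklore] -/
theorem isAlgebraic_adjoin_of_isAlgebraic_subfield {K F : Subfield Ω} {s : Set Ω} (hKF : K ≤ F)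
    (hsF : s ⊆ F) (hF : ∀ w ∈ F, IsAlgebraic (IntermediateField.adjoin K s) w) {z : Ω}
    (hz : IsAlgebraic F z) : IsAlgebraic (IntermediateField.adjoin K s) z := by
  rw [← isAlgebraic_closure_iff]
  exact isAlgebraic_trans_subfield (Subfield.closure_le.mpr (Set.union_subset hKF hsF))
    (fun w hw => (isAlgebraic_closure_iff K s w).mpr (hF w hw)) hz

/-! ## Finitely generated extensions of a perfect subfield are separably generated -/

/-- Over a perfect subfield `K`, a finitely generated `F ⊇ K` is separably generated (Mathlib's
`exists_isTranscendenceBasis_and_isSeparable_of_perfectField`, translated to subfields).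
[folklore] -/
theorem separablyGeneratedOver_of_perfectField {K F : Subfield Ω} [PerfectField K]
    (hfg : FGOver K F) : SeparablyGeneratedOver K F := by
  classical
  obtain ⟨s, hs⟩ := hfg
  set M : IntermediateField K Ω := IntermediateField.adjoin K (s : Set Ω) with hM
  have hMF : ∀ x : Ω, x ∈ M ↔ x ∈ F := fun x => by
    rw [hM, mem_adjoin_subfield_iff, hs]
  haveI : Algebra.EssFiniteType K M :=
    IntermediateField.essFiniteType_iff.mpr (IntermediateField.fg_adjoin_finset s)
  obtain ⟨s₀, hs₀, hsep⟩ := exists_isTranscendenceBasis_and_isSeparable_of_perfectField K M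
  set t : Finset Ω := s₀.image Subtype.val with ht
  have hims : Subtype.val '' (s₀ : Set M) = (t : Set Ω) := by
    rw [ht, Finset.coe_image]
  refine ⟨t, ?_, ?_, ?_⟩
  · intro x hx
    obtain ⟨y, -, rfl⟩ := Finset.mem_image.mp hx
    exact (hMF _).mp y.2
  · -- algebraic independence in `Ω`
    have he : ∀ x : t, ∃ y : s₀, ((y : M) : Ω) = (x : Ω) := fun x => by
      obtain ⟨y, hy, hyx⟩ := Finset.mem_image.mp x.2
      exact ⟨⟨y, hy⟩, hyx⟩
    choose e he using he
    have hinj : Function.Injective e := fun a b hab =>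
      Subtype.ext (by rw [← he a, ← he b, hab])
    have h1 := (hs₀.1.comp e hinj).map' (f := M.val) fun a b h => Subtype.ext h
    convert h1 using 1
    funext x
    exact (he x).symm
  · intro x hxF
    have hxM : x ∈ M := (hMF x).mpr hxF
    have h1 : IsSeparable (IntermediateField.adjoin K (s₀ : Set M)) (⟨x, hxM⟩ : M) :=
      Algebra.IsSeparable.isSeparable _ _
    have h2 : IsSeparable (IntermediateField.adjoin K (s₀ : Set M)) x := by
      have hmin := minpoly.algebraMap_eq (A := IntermediateField.adjoin K (s₀ : Set M))
        (algebraMap M Ω).injective (⟨x, hxM⟩ : M)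
      change (minpoly _ x).Separable
      have hx' : (algebraMap M Ω) ⟨x, hxM⟩ = x := rfl
      rw [hx'] at hmin
      rw [hmin]
      exact h1
    have hPs : ∀ y : IntermediateField.adjoin K (s₀ : Set M),
        ((y : M) : Ω) ∈ IntermediateField.adjoin K (t : Set Ω) := by
      intro y
      have hy : ((y : M) : Ω) ∈ IntermediateField.lift (IntermediateField.adjoin K (s₀ : Set M)) :=
        (IntermediateField.mem_lift (y : M)).mpr y.2
      rwa [IntermediateField.lift_adjoin, hims] at hy
    let f : IntermediateField.adjoin K (s₀ : Set M) →+* IntermediateField.adjoin K (t : Set Ω) :=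
      { toFun := fun y => ⟨((y : M) : Ω), hPs y⟩
        map_one' := rfl
        map_mul' := fun _ _ => rfl
        map_zero' := rfl
        map_add' := fun _ _ => rfl }
    exact isSeparable_of_ringHom_comp_eq f (RingHom.ext fun _ => rfl) h2

/-! ## The perfect hull of a subfield inside `Ω` -/

section PerfectHull

variable (k : Subfield Ω)

/-- The **relative perfect closure** of the subfield `k` in `Ω`: the elements of `Ω` with a
`p`-power-th power in `k` (Mathlib's `perfectClosure k Ω`, as a subfield of `Ω`). It is the
perfect hull `k^{1/p^∞}` when `Ω` is perfect (e.g. algebraically closed), cf. the instance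
`perfectField_perfectHull`; in general it need not be perfect. [folklore] -/
def perfectHull : Subfield Ω := (perfectClosure k Ω).toSubfield

/-- Membership in the perfect hull. [folklore] -/
theorem mem_perfectHull_iff {x : Ω} :
    x ∈ perfectHull k ↔ ∃ n : ℕ, x ^ (ringExpChar k) ^ n ∈ k := by
  rw [perfectHull, IntermediateField.mem_toSubfield, mem_perfectClosure_iff]
  simp only [RingHom.mem_range]
  constructor
  · rintro ⟨n, y, hy⟩
    exact ⟨n, hy ▸ y.2⟩
  · rintro ⟨n, hn⟩
    exact ⟨n, ⟨_, hn⟩, rfl⟩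

/-- `k ⊆ perfectHull k`. [folklore] -/
theorem le_perfectHull : k ≤ perfectHull k := fun x hx =>
  (mem_perfectHull_iff k).mpr ⟨0, by simpa using hx⟩

/-- The exponential characteristic of a subfield is that of the ambient field. [folklore] -/
theorem ringExpChar_subfield_eq : ringExpChar k = ringExpChar Ω := by
  haveI := expChar_of_injective_ringHom (algebraMap k Ω).injective (ringExpChar k)
  exact (ringExpChar.eq Ω (ringExpChar k)).symm

/-- Membership in the perfect hull, with the exponential characteristic of `Ω`. [folklore] -/
theorem mem_perfectHull_iff' {x : Ω} :
    x ∈ perfectHull k ↔ ∃ n : ℕ, x ^ (ringExpChar Ω) ^ n ∈ k := by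
  rw [mem_perfectHull_iff, ringExpChar_subfield_eq]

/-- If `k ⊆ V` then `perfectHull k ⊆ V`. [folklore] -/
theorem perfectHull_subset_valuationSubring {V : ValuationSubring Ω} (hk : (k : Set Ω) ⊆ V) :
    (perfectHull k : Set Ω) ⊆ V := by
  intro x hx
  obtain ⟨n, hn⟩ := (mem_perfectHull_iff' k).mp hx
  haveI := ExpChar.exists Ω |>.choose_spec
  have hq : (ringExpChar Ω) ^ n ≠ 0 :=
    pow_ne_zero n (expChar_pos Ω (ringExpChar Ω)).ne'
  exact mem_of_pow_mem hq (hk hn)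

/-- Elements of the perfect hull are algebraic over `k`. [folklore] -/
theorem isAlgebraic_of_mem_perfectHull {x : Ω} (hx : x ∈ perfectHull k) : IsAlgebraic k x := by
  have : IsAlgebraic k (⟨x, hx⟩ : perfectClosure k Ω) := Algebra.IsAlgebraic.isAlgebraic _
  exact IntermediateField.isAlgebraic_iff.mp this

/-- The perfect hull of `k` inside a perfect field is perfect. [folklore] -/
instance perfectField_perfectHull [PerfectField Ω] : PerfectField (perfectHull k) :=
  inferInstanceAs (PerfectField (perfectClosure k Ω))

/-- A finitely generated subextension of the perfect hull is finite purely inseparable.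
[folklore] -/
theorem finitePurelyInseparableOver_of_le_perfectHull {M : Subfield Ω} (hfg : FGOver k M)
    (hM : M ≤ perfectHull k) : FinitePurelyInseparableOver k M := by
  obtain ⟨s, hs⟩ := hfg
  refine ⟨s, fun x hx => ?_, hs⟩
  have hxM : x ∈ M := hs ▸ Subfield.subset_closure (Or.inr hx)
  exact (mem_perfectHull_iff' k).mp (hM hxM)

end PerfectHull

/-! ## Perfectness of residue fields -/

/-- If `K ⊆ V` and `K` is perfect then the residue field `KP` (`resField V K`) is perfect: the
`p`-th root in `K` of an element of `V ∩ K` lies in `V ∩ K` and its residue is a `p`-th root of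
the residue. [folklore] -/
theorem perfectField_resField {V : ValuationSubring Ω} {K : Subfield Ω} (hKV : (K : Set Ω) ⊆ V)
    [PerfectField K] : PerfectField (resField V K) := by
  obtain ⟨p, hp⟩ := ExpChar.exists K
  let ι₀ : K →+* ResidueField V :=
    (residue V).comp (Subring.inclusion (show K.toSubring ≤ V.toSubring from hKV))
  let ι : K →+* resField V K := ι₀.codRestrict (resField V K) fun c => residue_mem_resField V _ c.2
  haveI : ExpChar (resField V K) p := expChar_of_injective_ringHom ι.injective p
  suffices hsurj : Function.Surjective (frobenius (resField V K) p) by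
    haveI : PerfectRing (resField V K) p := PerfectRing.ofSurjective _ p hsurj
    exact PerfectRing.toPerfectField _ p
  rintro ⟨r, hr⟩
  obtain ⟨a, haK, rfl⟩ := (mem_resField_iff V K r).mp hr
  obtain ⟨b, hb⟩ := (PerfectField.toPerfectRing (K := K) p).bijective_frobenius.2 ⟨a, haK⟩
  have hb' : (b : Ω) ^ p = a := congrArg Subtype.val hb
  have hbV : (b : Ω) ∈ V := mem_of_pow_mem (expChar_pos K p).ne' (hb' ▸ a.2)
  refine ⟨⟨residue V ⟨b, hbV⟩, residue_mem_resField V _ b.2⟩, Subtype.ext ?_⟩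
  simp only [frobenius_def]
  change (residue V ⟨b, hbV⟩) ^ p = residue V a
  rw [← map_pow]
  congr 1
  exact Subtype.ext hb'

/-! ## Bookkeeping for finitely generated / finite extensions inside `Ω` -/

section FG

variable {K F E : Subfield Ω}

/-- `FGOver K F` entails `K ≤ F`. [folklore] -/
theorem le_of_fgOver (h : FGOver K F) : K ≤ F := by
  obtain ⟨s, rfl⟩ := h
  exact fun x hx => Subfield.subset_closure (Or.inl hx)

/-- Finite ⇒ finitely generated. [folklore] -/
theorem FiniteOver.fgOver (h : FiniteOver K F) : FGOver K F := by
  obtain ⟨s, -, hs⟩ := h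
  exact ⟨s, hs⟩

/-- Finite separable ⇒ finite. [folklore] -/
theorem FiniteSeparableOver.finiteOver (h : FiniteSeparableOver K F) : FiniteOver K F := by
  obtain ⟨s, hsep, hs⟩ := h
  exact ⟨s, fun x hx => (hsep x hx).isIntegral.isAlgebraic, hs⟩

/-- In a finite extension every element is algebraic. [folklore] -/
theorem FiniteOver.isAlgebraic (h : FiniteOver K F) {x : Ω} (hx : x ∈ F) : IsAlgebraic K x := by
  obtain ⟨s, hsalg, hs⟩ := h
  exact isAlgebraic_of_mem_closure hsalg (hs ▸ hx :)

/-- In a finite separable extension every element is separable. [folklore] -/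
theorem FiniteSeparableOver.isSeparable (h : FiniteSeparableOver K F) {x : Ω} (hx : x ∈ F) :
    IsSeparable K x := by
  obtain ⟨s, hsep, hs⟩ := h
  exact isSeparable_of_mem_closure hsep (hs ▸ hx :)

/-- `Subfield.closure (K ∪ s)` is monotone in `K`. [folklore] -/
theorem closure_union_mono_left {K K' : Subfield Ω} (h : K ≤ K') (s : Set Ω) :
    Subfield.closure ((K : Set Ω) ∪ s) ≤ Subfield.closure ((K' : Set Ω) ∪ s) :=
  Subfield.closure_mono (Set.union_subset_union_left s h)

/-- `closure (K ∪ s) = K ⊔ closure s`. [folklore] -/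
theorem closure_union_eq_sup (K : Subfield Ω) (s : Set Ω) :
    Subfield.closure ((K : Set Ω) ∪ s) = K ⊔ Subfield.closure s := by
  rw [Subfield.closure_union, Subfield.closure_eq]

/-- Transitivity: `F|K` and `E|F` finitely generated ⇒ `E|K` finitely generated. [folklore] -/
theorem FGOver.trans (hKF : FGOver K F) (hFE : FGOver F E) : FGOver K E := by
  classical
  obtain ⟨s, rfl⟩ := hKF
  obtain ⟨s', rfl⟩ := hFE
  refine ⟨s ∪ s', ?_⟩
  rw [Finset.coe_union, closure_union_eq_sup, closure_union_eq_sup, closure_union_eq_sup,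
    Subfield.closure_union, sup_assoc]

/-- Base change: `F|K` finitely generated and `K ≤ K'` ⇒ `F ⊔ K' | K'` finitely generated.
[folklore] -/
theorem FGOver.sup_right {K' : Subfield Ω} (hKF : FGOver K F) (h : K ≤ K') :
    FGOver K' (F ⊔ K') := by
  obtain ⟨s, rfl⟩ := hKF
  refine ⟨s, ?_⟩
  rw [closure_union_eq_sup, closure_union_eq_sup, sup_comm (K ⊔ Subfield.closure ↑s) K',
    ← sup_assoc, sup_eq_left.mpr h]

/-- The extension generated by a finite set is finitely generated. [folklore] -/
theorem fgOver_closure (K : Subfield Ω) (s : Finset Ω) :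
    FGOver K (Subfield.closure ((K : Set Ω) ∪ s)) :=
  ⟨s, rfl⟩

/-- Shrinking the extension from below keeps it finitely generated. [folklore] -/
theorem FGOver.mono_left {F₀ : Subfield Ω} (h : FGOver K F) (hK : K ≤ F₀) (hF₀ : F₀ ≤ F) :
    FGOver F₀ F := by
  obtain ⟨s, hs⟩ := h
  refine ⟨s, le_antisymm ?_ ?_⟩
  · refine Subfield.closure_le.mpr (Set.union_subset hF₀ ?_)
    exact fun x hx => hs ▸ Subfield.subset_closure (Or.inr hx)
  · exact hs ▸ closure_union_mono_left hK _

/-- A finitely generated `F ⊇ k` is generated over `k` by finitely many elements of `V ∩ F`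
(replace a generator `x ∉ V` by `x⁻¹ ∈ V`). [folklore] -/
theorem FGOver.exists_finset_subset (V : ValuationSubring Ω) {k F : Subfield Ω} (h : FGOver k F) :
    ∃ s : Finset Ω, (∀ x ∈ s, x ∈ V ∧ x ∈ F) ∧ Subfield.closure ((k : Set Ω) ∪ s) = F := by
  classical
  obtain ⟨t, ht⟩ := h
  have htF : ∀ x ∈ t, x ∈ F := fun x hx => ht ▸ Subfield.subset_closure (Or.inr hx)
  have hkF : k ≤ F := fun x hx => ht ▸ Subfield.subset_closure (Or.inl hx)
  let f : Ω → Ω := fun x => if x ∈ V then x else x⁻¹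
  have hf : ∀ x, (f x ∈ V ∧ (x ∈ F → f x ∈ F)) ∧ (f x = x ∨ f x = x⁻¹) := by
    intro x
    by_cases hxV : x ∈ V
    · have : f x = x := by simp [f, hxV]
      rw [this]
      exact ⟨⟨hxV, id⟩, Or.inl rfl⟩
    · have : f x = x⁻¹ := by simp [f, hxV]
      rw [this]
      exact ⟨⟨(V.mem_or_inv_mem x).resolve_left hxV, fun hxF => inv_mem hxF⟩, Or.inr rfl⟩
  refine ⟨t.image f, ?_, ?_⟩
  · intro y hy
    obtain ⟨x, hx, rfl⟩ := Finset.mem_image.mp hy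
    exact ⟨(hf x).1.1, (hf x).1.2 (htF x hx)⟩
  · apply le_antisymm
    · refine Subfield.closure_le.mpr ?_
      rintro y (hy | hy)
      · exact hkF hy
      · obtain ⟨x, hx, rfl⟩ := Finset.mem_image.mp hy
        exact (hf x).1.2 (htF x hx)
    · rw [← ht]
      refine Subfield.closure_le.mpr ?_
      rintro x (hx | hx)
      · exact Subfield.subset_closure (Or.inl hx)
      · have hfx : f x ∈ Subfield.closure ((k : Set Ω) ∪ ↑(t.image f)) :=
          Subfield.subset_closure (Or.inr (Finset.mem_image_of_mem f hx))
        rcases (hf x).2 with h | h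
        · rwa [h] at hfx
        · rw [h] at hfx
          simpa using inv_mem hfx

end FG

/-! ## Consequences of the data of Prop. 2.3 for the Abhyankar subfunction field `F₀ = K(x, y)` -/

section Prop23Consequences

variable {V : ValuationSubring Ω} {K F : Subfield Ω} {ρ τ : ℕ} {x : Fin ρ → Ω} {y : Fin τ → Ω}

/-- `K(x, y)` is finitely generated over `K`. [folklore] -/
theorem fgOver_closure_range (K : Subfield Ω) (x : Fin ρ → Ω) (y : Fin τ → Ω) :
    FGOver K (Subfield.closure ((K : Set Ω) ∪ (Set.range x ∪ Set.range y))) := by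
  classical
  refine ⟨Finset.univ.image x ∪ Finset.univ.image y, ?_⟩
  simp only [Finset.coe_union, Finset.coe_image, Finset.coe_univ, Set.image_univ]

/-- `vF/vF₀` is torsion when the values of `x` span `vF/vK` modulo torsion. [folklore] -/
theorem isValueTorsionOver_closure
    (hvs : ∀ a ∈ F, a ≠ 0 → ∃ n : ℕ, n ≠ 0 ∧ ∃ (m : Fin ρ → ℤ), ∃ b ∈ K,
      V.valuation (a ^ n) = V.valuation b * ∏ i, V.valuation (x i) ^ (m i)) :
    IsValueTorsionOver V (Subfield.closure ((K : Set Ω) ∪ (Set.range x ∪ Set.range y))) F := by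
  intro a ha ha0
  set F0 := Subfield.closure ((K : Set Ω) ∪ (Set.range x ∪ Set.range y)) with hF0
  obtain ⟨n, hn, m, b, hbK, hb⟩ := hvs a ha ha0
  have hbF0 : b ∈ F0 := Subfield.subset_closure (Or.inl hbK)
  have hxF0 : ∀ i, x i ∈ F0 := fun i => Subfield.subset_closure (Or.inr (Or.inl ⟨i, rfl⟩))
  refine ⟨n, hn, b * ∏ i, x i ^ (m i), ?_, ?_⟩
  · exact mul_mem hbF0 (prod_mem fun i _ => zpow_mem (hxF0 i) _)
  · rw [hb, map_mul, map_prod]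
    simp only [map_zpow₀]

/-- `FP|F₀P` is algebraic when `FP` is algebraic over `KP(yP)`. [folklore] -/
theorem isResiduallyAlgebraicOver_closure (hy : ∀ j, y j ∈ V)
    (hrs : ∀ r ∈ resField V F, IsAlgebraic (IntermediateField.adjoin (resField V K)
      (Set.range fun j => residue V ⟨y j, hy j⟩)) r) :
    IsResiduallyAlgebraicOver V (Subfield.closure ((K : Set Ω) ∪ (Set.range x ∪ Set.range y)))
      F := by
  intro r hr
  set M₀ := IntermediateField.adjoin (resField V K) (Set.range fun j => residue V ⟨y j, hy j⟩)
  set R₀ := resField V (Subfield.closure ((K : Set Ω) ∪ (Set.range x ∪ Set.range y)))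
  -- `M₀ ⊆ R₀` inside the residue field
  have hK : resField V K ≤ R₀ :=
    resField_mono V fun z hz => Subfield.subset_closure (Or.inl hz)
  have hle : (M₀ : Set (ResidueField V)) ⊆ R₀ := by
    have : M₀ ≤ R₀.toIntermediateField (fun c => hK c.2) := by
      refine IntermediateField.adjoin_le_iff.mpr ?_
      rintro _ ⟨j, rfl⟩
      exact residue_mem_resField V _ (Subfield.subset_closure (Or.inr (Or.inr ⟨j, rfl⟩)))
    exact fun z hz => this hz
  let f : M₀ →+* R₀ :=
    { toFun := fun z => ⟨z, hle z.2⟩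
      map_one' := rfl
      map_mul' := fun _ _ => rfl
      map_zero' := rfl
      map_add' := fun _ _ => rfl }
  exact isAlgebraic_of_ringHom_comp_eq f (RingHom.ext fun _ => rfl) (hrs r hr)

/-- `P|F₀` is an Abhyankar place of `F₀ = K(x, y)`. [folklore] -/
theorem isAbhyankarPlace_closure (hy : ∀ j, y j ∈ V)
    (hvi : ∀ m : Fin ρ → ℤ,
      (∃ b ∈ K, (∏ i, V.valuation (x i) ^ (m i)) = V.valuation b) → m = 0)
    (hri : AlgebraicIndependent (resField V K) (fun j => residue V ⟨y j, hy j⟩)) :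
    IsAbhyankarPlace V K (Subfield.closure ((K : Set Ω) ∪ (Set.range x ∪ Set.range y))) := by
  set F0 := Subfield.closure ((K : Set Ω) ∪ (Set.range x ∪ Set.range y)) with hF0
  have hxF0 : ∀ i, x i ∈ F0 := fun i => Subfield.subset_closure (Or.inr (Or.inl ⟨i, rfl⟩))
  have hyF0 : ∀ j, y j ∈ F0 := fun j => Subfield.subset_closure (Or.inr (Or.inr ⟨j, rfl⟩))
  have hx0 : ∀ i, x i ≠ 0 := by
    intro i hxi
    have h := hvi (Pi.single i 1) ⟨0, K.zero_mem, ?_⟩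
    · have : (Pi.single i 1 : Fin ρ → ℤ) i = 0 := by rw [h]; rfl
      simp at this
    · rw [map_zero]
      apply Finset.prod_eq_zero (Finset.mem_univ i)
      simp [hxi]
  refine ⟨ρ, τ, x, y, hy, fun i => ⟨hxF0 i, hx0 i⟩, hyF0, hvi, hri, fun z hz => ?_⟩
  have hz' : z ∈ IntermediateField.adjoin K (Set.range x ∪ Set.range y) :=
    (mem_adjoin_subfield_iff K _ z).mpr hz
  exact isAlgebraic_algebraMap
    (⟨z, hz'⟩ : IntermediateField.adjoin K (Set.range x ∪ Set.range y))

/-- `F|F₀` is separably generated, with separating transcendence basis `t`. [folklore] -/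
theorem separablyGeneratedOver_closure {t : Finset Ω} (htF : (t : Set Ω) ⊆ F)
    (hind : AlgebraicIndependent K (Sum.elim (Sum.elim x y) ((↑) : t → Ω)))
    (hsep : ∀ z ∈ F, IsSeparable
      (IntermediateField.adjoin K (Set.range x ∪ Set.range y ∪ (t : Set Ω))) z) :
    SeparablyGeneratedOver (Subfield.closure ((K : Set Ω) ∪ (Set.range x ∪ Set.range y))) F := by
  classical
  set F0 := Subfield.closure ((K : Set Ω) ∪ (Set.range x ∪ Set.range y)) with hF0
  refine ⟨t, htF, ?_, ?_⟩
  · -- `t` is algebraically independent over `F₀`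
    have h1 : AlgebraicIndependent K (Sum.elim ((↑) : t → Ω) (Sum.elim x y)) := by
      have hsw : Function.Injective (Sum.swap : ↥t ⊕ (Fin ρ ⊕ Fin τ) → (Fin ρ ⊕ Fin τ) ⊕ ↥t) :=
        fun a b h => by simpa using congrArg Sum.swap h
      have := hind.comp _ hsw
      rwa [Sum.elim_swap] at this
    have h2 : AlgebraicIndependent (Algebra.adjoin K (Set.range (Sum.elim x y)))
        ((↑) : t → Ω) := (AlgebraicIndependent.sumElim_iff.mp h1).2
    have h3 : AlgebraicIndependent (IntermediateField.adjoin K (Set.range (Sum.elim x y)))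
        ((↑) : t → Ω) := IntermediateField.algebraicIndependent_adjoin_iff.mpr h2
    -- transport from `K(x, y)` (intermediate field) to `F₀` (subfield): same subset of `Ω`
    have hrange : Set.range (Sum.elim x y) = Set.range x ∪ Set.range y := Set.Sum.elim_range x y
    have hmem : ∀ z : Ω, z ∈ IntermediateField.adjoin K (Set.range (Sum.elim x y)) ↔ z ∈ F0 :=
      fun z => by rw [hrange, mem_adjoin_subfield_iff]
    let f : IntermediateField.adjoin K (Set.range (Sum.elim x y)) →+* F0 :=
      { toFun := fun z => ⟨z, (hmem z).mp z.2⟩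
        map_one' := rfl
        map_mul' := fun _ _ => rfl
        map_zero' := rfl
        map_add' := fun _ _ => rfl }
    have hf : Function.Surjective f := fun z => ⟨⟨z, (hmem z).mpr z.2⟩, rfl⟩
    exact h3.ringHom_of_comp_eq f (RingHom.id Ω) hf (fun a b h => h) (RingHom.ext fun _ => rfl)
  · intro z hz
    -- `K(x, y, t) ⊆ F₀(t)` as subsets of `Ω`
    have hle : ∀ w : Ω, w ∈ IntermediateField.adjoin K (Set.range x ∪ Set.range y ∪ (t : Set Ω)) →
        w ∈ IntermediateField.adjoin F0 (t : Set Ω) := by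
      intro w hw
      rw [mem_adjoin_subfield_iff] at hw ⊢
      refine Subfield.closure_le.mpr ?_ hw
      rintro u (hu | hu | hu)
      · exact Subfield.subset_closure (Or.inl (Subfield.subset_closure (Or.inl hu)))
      · exact Subfield.subset_closure (Or.inl (Subfield.subset_closure (Or.inr hu)))
      · exact Subfield.subset_closure (Or.inr hu)
    let f : IntermediateField.adjoin K (Set.range x ∪ Set.range y ∪ (t : Set Ω)) →+*
        IntermediateField.adjoin F0 (t : Set Ω) :=
      { toFun := fun w => ⟨w, hle w w.2⟩
        map_one' := rfl
        map_mul' := fun _ _ => rfl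
        map_zero' := rfl
        map_add' := fun _ _ => rfl }
    exact isSeparable_of_ringHom_comp_eq f (RingHom.ext fun _ => rfl) (hsep z hz)

/-- An Abhyankar place of `F₀ = K(x, y)` (witnessed by `x, y`) stays Abhyankar on every
extension `F₀' ⊇ F₀` all of whose elements are algebraic over `F₀` (same witnesses).
[folklore] -/
theorem isAbhyankarPlace_of_algebraic {F₀' : Subfield Ω} (hy : ∀ j, y j ∈ V)
    (hvi : ∀ m : Fin ρ → ℤ,
      (∃ b ∈ K, (∏ i, V.valuation (x i) ^ (m i)) = V.valuation b) → m = 0)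
    (hri : AlgebraicIndependent (resField V K) (fun j => residue V ⟨y j, hy j⟩))
    (hle : Subfield.closure ((K : Set Ω) ∪ (Set.range x ∪ Set.range y)) ≤ F₀')
    (halg : ∀ z ∈ F₀', IsAlgebraic
      (Subfield.closure ((K : Set Ω) ∪ (Set.range x ∪ Set.range y))) z) :
    IsAbhyankarPlace V K F₀' := by
  have hxF0 : ∀ i, x i ∈ F₀' := fun i =>
    hle (Subfield.subset_closure (Or.inr (Or.inl ⟨i, rfl⟩)))
  have hyF0 : ∀ j, y j ∈ F₀' := fun j =>
    hle (Subfield.subset_closure (Or.inr (Or.inr ⟨j, rfl⟩)))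
  have hx0 : ∀ i, x i ≠ 0 := by
    intro i hxi
    have h := hvi (Pi.single i 1) ⟨0, K.zero_mem, ?_⟩
    · have : (Pi.single i 1 : Fin ρ → ℤ) i = 0 := by rw [h]; rfl
      simp at this
    · rw [map_zero]
      apply Finset.prod_eq_zero (Finset.mem_univ i)
      simp [hxi]
  refine ⟨ρ, τ, x, y, hy, fun i => ⟨hxF0 i, hx0 i⟩, hyF0, hvi, hri, fun z hz => ?_⟩
  exact (isAlgebraic_closure_iff K _ z).mp (halg z hz)

end Prop23Consequences

/-! ## Transport of smooth uniformizability along an isomorphism of base rings -/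

section BaseChange

variable {R R' : Type*} [CommRing R] [CommRing R'] [Algebra R Ω] [Algebra R' Ω]

/-- Finite presentation is insensitive to replacing the base ring by an isomorphic one acting
on `Ω` in the same way. [folklore] -/
theorem finitePresentation_of_ringEquiv_base (e : R ≃+* R')
    (he : ∀ r, algebraMap R' Ω (e r) = algebraMap R Ω r)
    (A : Subalgebra R Ω) (A' : Subalgebra R' Ω) (hAA' : ∀ x, x ∈ A ↔ x ∈ A')
    [Algebra.FinitePresentation R A] : Algebra.FinitePresentation R' A' := by
  -- `A` as an `R'`-algebra through `e.symm`
  letI algR : Algebra R' R := e.symm.toRingHom.toAlgebra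
  letI alg : Algebra R' A := ((algebraMap R A).comp e.symm.toRingHom).toAlgebra
  haveI : IsScalarTower R' R A := IsScalarTower.of_algebraMap_eq fun _ => rfl
  -- `R` is finitely presented over `R'` (it is isomorphic to it)
  let eR : R' ≃ₐ[R'] R :=
    { e.symm with
      commutes' := fun r => rfl }
  haveI : Algebra.FinitePresentation R' R := Algebra.FinitePresentation.equiv eR
  haveI : Algebra.FinitePresentation R' A := Algebra.FinitePresentation.trans R' R A
  -- `A ≃ A'` over `R'`
  let eA : A ≃ₐ[R'] A' :=
    { toFun := fun x => ⟨x.1, (hAA' x.1).mp x.2⟩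
      invFun := fun x => ⟨x.1, (hAA' x.1).mpr x.2⟩
      left_inv := fun _ => rfl
      right_inv := fun _ => rfl
      map_mul' := fun _ _ => rfl
      map_add' := fun _ _ => rfl
      commutes' := fun r => by
        apply Subtype.ext
        change algebraMap R Ω (e.symm r) = algebraMap R' Ω r
        rw [← he, e.apply_symm_apply] }
  exact Algebra.FinitePresentation.equiv eA

/-- Formal smoothness of the local ring at the centre is insensitive to replacing the base ring
by an isomorphic one acting on `Ω` in the same way. [folklore] -/
theorem isSmoothAt_centre_of_ringEquiv_base (e : R ≃+* R')
    (he : ∀ r, algebraMap R' Ω (e r) = algebraMap R Ω r)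
    (A : Subalgebra R Ω) (A' : Subalgebra R' Ω) (hAA' : ∀ x, x ∈ A ↔ x ∈ A')
    (V : ValuationSubring Ω) (hAV : A.toSubring ≤ V.toSubring) (hA'V : A'.toSubring ≤ V.toSubring)
    (h : Algebra.IsSmoothAt R (centre A V hAV)) : Algebra.IsSmoothAt R' (centre A' V hA'V) := by
  set q := centre A V hAV
  set q' := centre A' V hA'V
  let X := Localization.AtPrime q
  let X' := Localization.AtPrime q'
  -- `X` as an `R'`-algebra through `e.symm`
  letI algR : Algebra R' R := e.symm.toRingHom.toAlgebra
  letI algX : Algebra R' X := ((algebraMap R X).comp e.symm.toRingHom).toAlgebra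
  haveI : IsScalarTower R' R X := IsScalarTower.of_algebraMap_eq fun _ => rfl
  let eR : R' ≃ₐ[R'] R :=
    { e.symm with
      commutes' := fun r => rfl }
  haveI : Algebra.FormallySmooth R' R := Algebra.FormallySmooth.of_equiv eR
  haveI : Algebra.FormallySmooth R X := h
  haveI hX : Algebra.FormallySmooth R' X := Algebra.FormallySmooth.comp R' R X
  -- the ring isomorphism `A ≃ A'` and the induced one on local rings
  let eA : A ≃+* A' :=
    { toFun := fun x => ⟨x.1, (hAA' x.1).mp x.2⟩
      invFun := fun x => ⟨x.1, (hAA' x.1).mpr x.2⟩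
      left_inv := fun _ => rfl
      right_inv := fun _ => rfl
      map_mul' := fun _ _ => rfl
      map_add' := fun _ _ => rfl }
  have hcompl : q.primeCompl.map eA.toMonoidHom = q'.primeCompl := by
    ext x
    simp only [Submonoid.mem_map, Ideal.mem_primeCompl_iff]
    constructor
    · rintro ⟨y, hy, rfl⟩
      rw [mem_centre_iff] at hy ⊢
      exact hy
    · intro hx
      refine ⟨⟨x.1, (hAA' x.1).mpr x.2⟩, ?_, rfl⟩
      rw [mem_centre_iff] at hx ⊢
      exact hx
  let eX : X ≃+* X' :=
    IsLocalization.ringEquivOfRingEquiv (M := q.primeCompl) (T := q'.primeCompl) X X' eA hcompl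
  have hcomm : ∀ r : R', eX (algebraMap R' X r) = algebraMap R' X' r := by
    intro r
    have h1 : algebraMap R' X r = algebraMap A X (algebraMap R A (e.symm r)) := by
      change algebraMap R X (e.symm r) = _
      exact IsScalarTower.algebraMap_apply R A X _
    have h2 : algebraMap R' X' r = algebraMap A' X' (algebraMap R' A' r) :=
      IsScalarTower.algebraMap_apply R' A' X' r
    rw [h1, h2]
    change IsLocalization.ringEquivOfRingEquiv (M := q.primeCompl) (T := q'.primeCompl) X X' eA
      hcompl _ = _
    rw [IsLocalization.ringEquivOfRingEquiv_eq]
    congr 1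
    apply Subtype.ext
    change algebraMap R Ω (e.symm r) = algebraMap R' Ω r
    rw [← he, e.apply_symm_apply]
  let eX' : X ≃ₐ[R'] X' := AlgEquiv.ofRingEquiv (f := eX) hcomm
  exact Algebra.FormallySmooth.of_equiv eX'

/-- **Base transport.** Smooth uniformizability over `R` is the same as over an isomorphic base
`R'` acting on `Ω` in the same way. [folklore] -/
theorem IsSmoothlyUniformizableIn.of_ringEquiv (e : R ≃+* R')
    (he : ∀ r, algebraMap R' Ω (e r) = algebraMap R Ω r) {V : ValuationSubring Ω}
    {E : Subfield Ω} {Z : Set Ω} (h : IsSmoothlyUniformizableIn R V E Z) :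
    IsSmoothlyUniformizableIn R' V E Z := by
  obtain ⟨A, hAV, hAE, hfp, hfrac, hsm, hZ⟩ := h
  let A' : Subalgebra R' Ω :=
    { A.toSubsemiring with
      algebraMap_mem' := fun r => by
        have := A.algebraMap_mem (e.symm r)
        rw [← he, e.apply_symm_apply] at this
        exact this }
  have hAA' : ∀ x, x ∈ A ↔ x ∈ A' := fun x => Iff.rfl
  have hA'V : A'.toSubring ≤ V.toSubring := fun x hx => hAV ((hAA' x).mpr hx)
  haveI := hfp
  refine ⟨A', hA'V, fun x hx => hAE ((hAA' x).mpr hx),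
    finitePresentation_of_ringEquiv_base e he A A' hAA', ?_, ?_, ?_⟩
  · intro x hx
    obtain ⟨a, ha, b, hb, rfl⟩ := hfrac x hx
    exact ⟨a, (hAA' a).mp ha, b, (hAA' b).mp hb, rfl⟩
  · exact isSmoothAt_centre_of_ringEquiv_base e he A A' hAA' V hAV hA'V hsm
  · intro z hz
    obtain ⟨a, ha, b, hb, hvb, rfl⟩ := hZ z hz
    exact ⟨a, (hAA' a).mp ha, b, (hAA' b).mp hb, hvb, rfl⟩

end BaseChange

/-! ## Subrings `V ∩ K` for subfields `K ⊆ V` -/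

/-- For a subfield `K ⊆ V`, the ring isomorphism `K ≃ V ∩ K` (it is
`(RingEquiv.subringCongr (inf_eq_right.mpr hKV)).symm` up to the coercions; spelled out for
definitional control of the maps to `Ω`). [folklore] -/
def subfieldEquivInfOfLe (V : ValuationSubring Ω) (K : Subfield Ω) (hKV : (K : Set Ω) ⊆ V) :
    K ≃+* ↥(V.toSubring ⊓ K.toSubring) where
  toFun x := ⟨x.1, hKV x.2, x.2⟩
  invFun x := ⟨x.1, x.2.2⟩
  left_inv _ := rfl
  right_inv _ := rfl
  map_mul' _ _ := rfl
  map_add' _ _ := rfl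

/-- `subfieldEquivInfOfLe` is compatible with the maps to `Ω`. [folklore] -/
theorem algebraMap_subfieldEquivInfOfLe (V : ValuationSubring Ω) (K : Subfield Ω)
    (hKV : (K : Set Ω) ⊆ V) (x : K) :
    algebraMap ↥(V.toSubring ⊓ K.toSubring) Ω (subfieldEquivInfOfLe V K hKV x) =
      algebraMap K Ω x := rfl

/-- Over a `K`-trivial valuation (`K ⊆ V`), smooth `K`-uniformizability and smooth
`O_K = V ∩ K`-uniformizability agree. [folklore] -/
theorem isSmoothlyUniformizableIn_inf_iff (V : ValuationSubring Ω) (K : Subfield Ω)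
    (hKV : (K : Set Ω) ⊆ V) (E : Subfield Ω) (Z : Set Ω) :
    IsSmoothlyUniformizableIn ↥(V.toSubring ⊓ K.toSubring) V E Z ↔
      IsSmoothlyUniformizableIn K V E Z := by
  constructor
  · intro h
    exact h.of_ringEquiv (subfieldEquivInfOfLe V K hKV).symm fun r => by
      rw [← algebraMap_subfieldEquivInfOfLe V K hKV, RingEquiv.apply_symm_apply]
  · intro h
    exact h.of_ringEquiv (subfieldEquivInfOfLe V K hKV) (algebraMap_subfieldEquivInfOfLe V K hKV)

/-- If `V ∩ K = V ∩ K'` as subrings of `Ω` (hypothesis `h`; e.g. for two presentations of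
the same subfield), smooth uniformizability over `V ∩ K` and over `V ∩ K'` agree. [folklore] -/
theorem isSmoothlyUniformizableIn_inf_congr (V : ValuationSubring Ω) {K K' : Subfield Ω}
    (h : V.toSubring ⊓ K.toSubring = V.toSubring ⊓ K'.toSubring) (E : Subfield Ω) (Z : Set Ω) :
    IsSmoothlyUniformizableIn ↥(V.toSubring ⊓ K.toSubring) V E Z ↔
      IsSmoothlyUniformizableIn ↥(V.toSubring ⊓ K'.toSubring) V E Z := by
  let e : ↥(V.toSubring ⊓ K.toSubring) ≃+* ↥(V.toSubring ⊓ K'.toSubring) :=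
    { toFun := fun x => ⟨x.1, h ▸ x.2⟩
      invFun := fun x => ⟨x.1, h.symm ▸ x.2⟩
      left_inv := fun _ => rfl
      right_inv := fun _ => rfl
      map_mul' := fun _ _ => rfl
      map_add' := fun _ _ => rfl }
  exact ⟨fun hZ => hZ.of_ringEquiv e fun _ => rfl, fun hZ => hZ.of_ringEquiv e.symm fun _ => rfl⟩

/-! ## Localising a subalgebra of a field away from an element -/

section LocAway

variable {R : Type*} [CommRing R] [Algebra R Ω]

/-- `B[1/f] ⊆ Ω` for a subalgebra `B` of the field `Ω` and `f ∈ B`: the elements `w` with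
`w * f ^ n ∈ B` for some `n` (for `f ≠ 0` these are the quotients `b / f ^ n`, `b ∈ B`). Junk
value: for `f = 0` this is all of `Ω` (`w * 0 ^ 1 = 0 ∈ B`); every lemma below about the
localisation takes `f ≠ 0`. [folklore] -/
def locAway (B : Subalgebra R Ω) (f : Ω) (hf : f ∈ B) : Subalgebra R Ω where
  carrier := {w | ∃ n : ℕ, w * f ^ n ∈ B}
  mul_mem' := by
    rintro w w' ⟨n, hn⟩ ⟨m, hm⟩
    refine ⟨n + m, ?_⟩
    have : w * w' * f ^ (n + m) = (w * f ^ n) * (w' * f ^ m) := by ring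
    rw [this]
    exact mul_mem hn hm
  add_mem' := by
    rintro w w' ⟨n, hn⟩ ⟨m, hm⟩
    refine ⟨n + m, ?_⟩
    have : (w + w') * f ^ (n + m) = (w * f ^ n) * f ^ m + (w' * f ^ m) * f ^ n := by ring
    rw [this]
    exact add_mem (mul_mem hn (pow_mem hf m)) (mul_mem hm (pow_mem hf n))
  algebraMap_mem' r := ⟨0, by simp⟩

variable {B : Subalgebra R Ω} {f : Ω} {hf : f ∈ B}

/-- Membership in `B[1/f]`. [folklore] -/
theorem mem_locAway_iff {w : Ω} : w ∈ locAway B f hf ↔ ∃ n : ℕ, w * f ^ n ∈ B := Iff.rfl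

/-- `B ⊆ B[1/f]`. [folklore] -/
theorem le_locAway : B ≤ locAway B f hf := fun w hw => ⟨0, by simpa using hw⟩

/-- `f⁻¹ ∈ B[1/f]`. [folklore] -/
theorem inv_mem_locAway (hf0 : f ≠ 0) : f⁻¹ ∈ locAway B f hf :=
  ⟨1, by rw [pow_one, inv_mul_cancel₀ hf0]; exact one_mem B⟩

/-- Elements of `B[1/f]` are the quotients `b / f ^ n`. [folklore] -/
theorem mem_locAway_iff_exists_div (hf0 : f ≠ 0) {w : Ω} :
    w ∈ locAway B f hf ↔ ∃ b ∈ B, ∃ n : ℕ, w = b / f ^ n := by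
  constructor
  · rintro ⟨n, hn⟩
    exact ⟨w * f ^ n, hn, n, by rw [mul_div_assoc, div_self (pow_ne_zero n hf0), mul_one]⟩
  · rintro ⟨b, hb, n, rfl⟩
    exact ⟨n, by rwa [div_mul_cancel₀ b (pow_ne_zero n hf0)]⟩

/-- `B[1/f]` is generated by generators of `B` and `f⁻¹`. [folklore] -/
theorem locAway_eq_adjoin (hf0 : f ≠ 0) {s : Set Ω} (hs : Algebra.adjoin R s = B) :
    locAway B f hf = Algebra.adjoin R (insert f⁻¹ s) := by
  apply le_antisymm
  · intro w hw
    obtain ⟨b, hb, n, rfl⟩ := (mem_locAway_iff_exists_div hf0).mp hw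
    rw [div_eq_mul_inv, ← inv_pow]
    refine mul_mem ?_ (pow_mem (Algebra.subset_adjoin (Set.mem_insert _ _)) n)
    rw [← hs] at hb
    exact Algebra.adjoin_mono (Set.subset_insert _ _) hb
  · refine Algebra.adjoin_le ?_
    rintro w (rfl | hw)
    · exact inv_mem_locAway hf0
    · exact le_locAway (hs ▸ Algebra.subset_adjoin hw)

/-- `B[1/f]` is finitely generated if `B` is. [folklore] -/
theorem fg_locAway (hf0 : f ≠ 0) (hB : B.FG) : (locAway B f hf).FG := by
  classical
  obtain ⟨s, hs⟩ := hB
  refine ⟨insert f⁻¹ s, ?_⟩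
  rw [Finset.coe_insert, ← locAway_eq_adjoin hf0 hs]

/-- If `B ⊆ V` and `f` is a unit of `V` then `B[1/f] ⊆ V`. [folklore] -/
theorem locAway_le_valuationSubring {V : ValuationSubring Ω} (hBV : B.toSubring ≤ V.toSubring)
    (hvf : V.valuation f = 1) : (locAway B f hf).toSubring ≤ V.toSubring := by
  rintro w ⟨n, hn⟩
  have h1 : V.valuation (w * f ^ n) ≤ 1 := (V.valuation_le_one_iff _).mpr (hBV hn)
  rw [map_mul, map_pow, hvf, one_pow, mul_one] at h1
  exact (V.valuation_le_one_iff w).mp h1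

/-- If `B ⊆ E` for a subfield `E` then `B[1/f] ⊆ E`. [folklore] -/
theorem locAway_subset_subfield {E : Subfield Ω} (hBE : (B : Set Ω) ⊆ E) (hf0 : f ≠ 0) :
    (locAway B f hf : Set Ω) ⊆ E := by
  intro w hw
  obtain ⟨b, hb, n, rfl⟩ := (mem_locAway_iff_exists_div hf0).mp hw
  exact div_mem (hBE hb) (pow_mem (hBE hf) n)

/-- `B[1/f]` is the localisation of `B` away from `f` (as a `B`-algebra via the inclusion).
[folklore] -/
theorem isLocalization_locAway (hf0 : f ≠ 0) :
    letI := (Subalgebra.inclusion (le_locAway (B := B) (f := f) (hf := hf))).toRingHom.toAlgebra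
    IsLocalization.Away (⟨f, hf⟩ : B) (locAway B f hf) := by
  letI := (Subalgebra.inclusion (le_locAway (B := B) (f := f) (hf := hf))).toRingHom.toAlgebra
  refine ⟨?_, ?_, ?_⟩
  · rintro ⟨_, n, rfl⟩
    refine isUnit_iff_exists_inv.mpr ⟨⟨(f ^ n)⁻¹, ?_⟩, ?_⟩
    · rw [← inv_pow]; exact pow_mem (inv_mem_locAway hf0) n
    · apply Subtype.ext
      change f ^ n * (f ^ n)⁻¹ = 1
      exact mul_inv_cancel₀ (pow_ne_zero n hf0)
  · rintro ⟨w, n, hn⟩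
    refine ⟨⟨⟨w * f ^ n, hn⟩, ⟨⟨f, hf⟩ ^ n, n, rfl⟩⟩, ?_⟩
    apply Subtype.ext
    change w * f ^ n = w * f ^ n
    rfl
  · intro a b h
    refine ⟨1, ?_⟩
    have : (a : Ω) = b := by
      have := congrArg (fun t : locAway B f hf => (t : Ω)) h
      exact this
    rw [Subtype.ext this]

/-- If `B_f` (abstract localisation) is smooth over `R` then so is `B[1/f] ⊆ Ω`. [folklore] -/
theorem smooth_locAway (hf0 : f ≠ 0)
    (h : Algebra.Smooth R (Localization.Away (⟨f, hf⟩ : B))) :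
    Algebra.Smooth R (locAway B f hf) := by
  letI := (Subalgebra.inclusion (le_locAway (B := B) (f := f) (hf := hf))).toRingHom.toAlgebra
  haveI : IsScalarTower R B (locAway B f hf) := IsScalarTower.of_algebraMap_eq fun _ => rfl
  haveI := isLocalization_locAway (B := B) (hf := hf) hf0
  let e : Localization.Away (⟨f, hf⟩ : B) ≃ₐ[B] locAway B f hf :=
    Localization.algEquiv (Submonoid.powers (⟨f, hf⟩ : B)) (locAway B f hf)
  exact Algebra.Smooth.of_equiv (e.restrictScalars R)

/-- If `B` is formally smooth over `R` then so is `B[1/f]`. [folklore] -/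
theorem formallySmooth_locAway (hf0 : f ≠ 0) [Algebra.FormallySmooth R B] :
    Algebra.FormallySmooth R (locAway B f hf) := by
  letI := (Subalgebra.inclusion (le_locAway (B := B) (f := f) (hf := hf))).toRingHom.toAlgebra
  haveI : IsScalarTower R B (locAway B f hf) := IsScalarTower.of_algebraMap_eq fun _ => rfl
  haveI := isLocalization_locAway (B := B) (hf := hf) hf0
  haveI : Algebra.FormallySmooth B (locAway B f hf) :=
    Algebra.FormallySmooth.of_isLocalization (Submonoid.powers (⟨f, hf⟩ : B))
  exact Algebra.FormallySmooth.comp R B (locAway B f hf)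

end LocAway

/-! ## Smooth algebras over a field are normal -/

/-- A domain of finite type and formally smooth over a field is integrally closed: its local
rings at maximal ideals are regular (EGA IV 17.5.8) hence normal (Matsumura 19.4).
[folklore] -/
theorem isIntegrallyClosed_of_formallySmooth (hreg : Grothendieck1967_17_5_8.{u})
    (h194 : Matsumura1987_19_4.{u}) (K B : Type u) [Field K] [CommRing B] [IsDomain B]
    [Algebra K B] [Algebra.FiniteType K B] [Algebra.FormallySmooth K B] :
    IsIntegrallyClosed B := by
  refine IsIntegrallyClosed.of_localization_maximal fun p _ hp => ?_
  haveI : Algebra.IsSmoothAt K p := by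
    haveI : Algebra.FormallySmooth B (Localization.AtPrime p) :=
      Algebra.FormallySmooth.of_isLocalization p.primeCompl
    exact Algebra.FormallySmooth.comp K B (Localization.AtPrime p)
  exact (h194 _ (hreg.of_field K B p this)).2

/-- Formal smoothness at every prime of a formally smooth algebra. [folklore] -/
theorem isSmoothAt_of_formallySmooth {K B : Type*} [CommRing K] [CommRing B] [Algebra K B]
    [Algebra.FormallySmooth K B] (p : Ideal B) [p.IsPrime] : Algebra.IsSmoothAt K p := by
  haveI : Algebra.FormallySmooth B (Localization.AtPrime p) :=
    Algebra.FormallySmooth.of_isLocalization p.primeCompl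
  exact Algebra.FormallySmooth.comp K B (Localization.AtPrime p)

/-! ## Improving a model over a field to a normal, everywhere smooth one -/

/-- From a model `B ⊆ V ∩ E` over the subfield `K`, smooth over `K` at the centre and with
`Z₁ ⊆ B_q`, pass to `B₂ := B[1/f][1/d] ⊆ V ∩ E`: finitely generated, formally smooth over `K`
everywhere, normal (EGA IV 17.5.8 + Matsumura 19.4), containing `Z₁`, with the same fraction
field. [folklore] -/
theorem exists_normal_smooth_model (hreg : Grothendieck1967_17_5_8.{u})
    (h194 : Matsumura1987_19_4.{u}) {K : Subfield Ω} {V : ValuationSubring Ω} {E : Subfield Ω}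
    {Z₁ : Finset Ω} (h : IsSmoothlyUniformizableIn K V E (Z₁ : Set Ω)) :
    ∃ (B₂ : Subalgebra K Ω), B₂.toSubring ≤ V.toSubring ∧ (B₂ : Set Ω) ⊆ E ∧ B₂.FG ∧
      Algebra.FormallySmooth K B₂ ∧ IsIntegrallyClosed B₂ ∧ (Z₁ : Set Ω) ⊆ B₂ ∧
      ∀ x ∈ E, ∃ a ∈ B₂, ∃ b ∈ B₂, x = a / b := by
  classical
  obtain ⟨B, hBV, hBE, hfp, hfrac, hsm, hZ⟩ := h
  haveI := hfp
  haveI : Algebra.IsSmoothAt K (centre B V hBV) := hsm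
  -- Step 1: `B₁ := B[1/f]` smooth everywhere
  obtain ⟨f, hfq, hfsm⟩ := Algebra.IsSmoothAt.exists_notMem_smooth K (centre B V hBV)
  have hvf : V.valuation (f : Ω) = 1 := by
    have h1 : V.valuation (f : Ω) ≤ 1 := (V.valuation_le_one_iff _).mpr (hBV f.2)
    have h2 : ¬ V.valuation (f : Ω) < 1 := fun hlt => hfq ((mem_centre_iff B V hBV f).mpr hlt)
    exact le_antisymm h1 (not_lt.mp h2)
  have hf0 : (f : Ω) ≠ 0 := fun h0 => by simp [h0] at hvf
  let B₁ := locAway B (f : Ω) f.2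
  have hsm₁ : Algebra.Smooth K B₁ := smooth_locAway hf0 (by simpa using hfsm)
  haveI : Algebra.FormallySmooth K B₁ := hsm₁.1
  have hB₁V : B₁.toSubring ≤ V.toSubring := locAway_le_valuationSubring hBV hvf
  have hB₁E : (B₁ : Set Ω) ⊆ E := locAway_subset_subfield hBE hf0
  have hBfg : B.FG := (Subalgebra.fg_iff_finiteType B).mpr inferInstance
  have hB₁fg : B₁.FG := fg_locAway hf0 hBfg
  -- Step 2: `B₂ := B₁[1/d]`, `d` the product of the denominators of `Z₁`
  choose a ha b hb hvb hab using hZ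
  let d : Ω := ∏ w ∈ Z₁.attach, b w.1 w.2
  have hdB : d ∈ B := prod_mem fun w _ => hb w.1 w.2
  have hvd : V.valuation d = 1 := by
    change V.valuation (∏ w ∈ Z₁.attach, b w.1 w.2) = 1
    rw [map_prod]
    exact Finset.prod_eq_one fun w _ => hvb w.1 w.2
  have hd0 : d ≠ 0 := fun h0 => by simp [h0] at hvd
  let B₂ := locAway B₁ d (le_locAway hdB)
  haveI : Algebra.FormallySmooth K B₂ := formallySmooth_locAway hd0
  have hB₂V : B₂.toSubring ≤ V.toSubring := locAway_le_valuationSubring hB₁V hvd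
  have hB₂E : (B₂ : Set Ω) ⊆ E := locAway_subset_subfield hB₁E hd0
  have hB₂fg : B₂.FG := fg_locAway hd0 hB₁fg
  haveI : Algebra.FiniteType K B₂ := (Subalgebra.fg_iff_finiteType B₂).mp hB₂fg
  have hnormal : IsIntegrallyClosed B₂ := isIntegrallyClosed_of_formallySmooth hreg h194 K B₂
  refine ⟨B₂, hB₂V, hB₂E, hB₂fg, inferInstance, hnormal, ?_, ?_⟩
  · intro w hw
    refine ⟨1, ?_⟩
    rw [pow_one]
    have hb0 : b w hw ≠ 0 := fun h0 => by simpa [h0] using hvb w hw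
    have hwb : w * b w hw = a w hw := by
      have h := hab w hw
      calc w * b w hw = a w hw / b w hw * b w hw := by rw [← h]
        _ = a w hw := div_mul_cancel₀ _ hb0
    have hprod := Finset.mul_prod_erase Z₁.attach (fun w' => b w'.1 w'.2)
      (Finset.mem_attach _ ⟨w, hw⟩)
    have hd : d = b w hw * ∏ w' ∈ Z₁.attach.erase ⟨w, hw⟩, b w'.1 w'.2 := hprod.symm
    rw [hd, ← mul_assoc, hwb]
    exact le_locAway (mul_mem (ha w hw) (prod_mem fun w' _ => hb w'.1 w'.2))
  · intro x hx
    obtain ⟨a', ha', b', hb', rfl⟩ := hfrac x hx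
    exact ⟨a', le_locAway (le_locAway ha'), b', le_locAway (le_locAway hb'), rfl⟩

/-! ## Composing a model over a smooth algebra with the structure map -/

/-- If `S` is a finitely generated, formally smooth `R`-algebra (`R` Noetherian) mapping to `Ω`
and `C ⊆ V ∩ E` is a finitely presented `S`-subalgebra of `Ω`, smooth over `S` at the centre of
`V`, with `Frac C = E` and `Z ⊆ C_q`, then `(V ∩ E, Z)` is smoothly `R`-uniformizable (by `C`
viewed over `R`; EGA IV 17.3.3 (ii): composites of smooth morphisms are smooth). [folklore] -/
theorem isSmoothlyUniformizableIn_of_tower {R : Type*} [CommRing R] [IsNoetherianRing R]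
    [Algebra R Ω] (S : Type*) [CommRing S] [Algebra R S] [Algebra S Ω] [IsScalarTower R S Ω]
    [Algebra.FormallySmooth R S] [Algebra.FiniteType R S]
    {V : ValuationSubring Ω} {E : Subfield Ω} {Z : Set Ω}
    (C : Subalgebra S Ω) (hCV : C.toSubring ≤ V.toSubring) (hCE : (C : Set Ω) ⊆ E)
    (hfp : Algebra.FinitePresentation S C) (hsm : Algebra.IsSmoothAt S (centre C V hCV))
    (hfrac : ∀ x ∈ E, ∃ a ∈ C, ∃ b ∈ C, x = a / b)
    (hZ : ∀ z ∈ Z, ∃ a ∈ C, ∃ b ∈ C, V.valuation b = 1 ∧ z = a / b) :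
    IsSmoothlyUniformizableIn R V E Z := by
  let C' : Subalgebra R Ω := C.restrictScalars R
  have hC'V : C'.toSubring ≤ V.toSubring := hCV
  haveI := hfp
  haveI : Algebra.FiniteType S C := inferInstance
  have hft : Algebra.FiniteType R C := Algebra.FiniteType.trans (S := S) inferInstance this
  have hft' : Algebra.FiniteType R C' := hft
  haveI : Algebra.FinitePresentation R C' :=
    (Algebra.FinitePresentation.of_finiteType (R := R) (A := C')).mp hft'
  refine ⟨C', hC'V, hCE, inferInstance, hfrac, ?_, hZ⟩
  -- smoothness over `R` at the centre: compose `R → S` (formally smooth) with `S → C_q`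
  set q := centre C V hCV with hq
  let L := Localization.AtPrime q
  haveI : Algebra.FormallySmooth S L := hsm
  haveI : IsScalarTower R S L := IsScalarTower.of_algebraMap_eq fun r => by
    rw [IsScalarTower.algebraMap_apply R C L, IsScalarTower.algebraMap_apply S C L]
    congr 1
    apply Subtype.ext
    exact IsScalarTower.algebraMap_apply R S Ω r
  have : Algebra.FormallySmooth R L := Algebra.FormallySmooth.comp R S L
  exact this

/-! ## A model contains its own generators -/

/-- From a smooth uniformization of `(V ∩ E, Z)` over the subfield `K` and a finite `s ⊆ E`
extract a finite `G ⊆` the model with: `(V ∩ E, Z ∪ G)` is smoothly `K`-uniformizable (by the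
same model), `E = K(G)`, and every element of `s` is a quotient of two elements of `G`.
[folklore] -/
theorem IsSmoothlyUniformizableIn.exists_gens {K : Subfield Ω} {V : ValuationSubring Ω}
    {E : Subfield Ω} {Z : Set Ω} (h : IsSmoothlyUniformizableIn K V E Z) (s : Finset Ω)
    (hs : (s : Set Ω) ⊆ E) :
    ∃ G : Finset Ω, (G : Set Ω) ⊆ E ∧ (G : Set Ω) ⊆ V ∧ IsSmoothlyUniformizableIn K V E (Z ∪ G) ∧
      Subfield.closure ((K : Set Ω) ∪ G) = E ∧ ∀ x ∈ s, ∃ a ∈ G, ∃ b ∈ G, x = a / b := by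
  classical
  obtain ⟨A, hAV, hAE, hfp, hfrac, hsm, hZ⟩ := h
  haveI := hfp
  obtain ⟨G₀, hG₀⟩ : A.FG := (Subalgebra.fg_iff_finiteType A).mpr inferInstance
  have hG₀A : (G₀ : Set Ω) ⊆ A := hG₀ ▸ Algebra.subset_adjoin
  choose a ha b hb hab using fun x (hx : x ∈ s) => hfrac x (hs hx)
  let G : Finset Ω := G₀ ∪ s.attach.image (fun x => a x.1 x.2) ∪ s.attach.image (fun x => b x.1 x.2)
  have hGA : (G : Set Ω) ⊆ A := by
    intro g hg
    simp only [G, Finset.coe_union, Finset.coe_image, Set.mem_union, Set.mem_image,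
      Finset.mem_coe, Finset.mem_attach, true_and, Subtype.exists] at hg
    rcases hg with (hg | ⟨x, hx, rfl⟩) | ⟨x, hx, rfl⟩
    · exact hG₀A hg
    · exact ha x hx
    · exact hb x hx
  refine ⟨G, fun g hg => hAE (hGA hg), fun g hg => hAV (hGA hg),
    ⟨A, hAV, hAE, hfp, hfrac, hsm, ?_⟩, ?_, ?_⟩
  · rintro z (hz | hz)
    · exact hZ z hz
    · exact ⟨z, hGA hz, 1, one_mem A, map_one _, by rw [div_one]⟩
  · apply le_antisymm
    · refine Subfield.closure_le.mpr (Set.union_subset ?_ fun g hg => hAE (hGA hg))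
      intro c hc
      exact hAE (A.algebraMap_mem (⟨c, hc⟩ : K))
    · intro x hx
      obtain ⟨a', ha', b', hb', rfl⟩ := hfrac x hx
      let T : Subalgebra K Ω :=
        { (Subfield.closure ((K : Set Ω) ∪ G)).toSubring.toSubsemiring with
          algebraMap_mem' := fun c => Subfield.subset_closure (Or.inl c.2) }
      have hAT : A ≤ T := by
        rw [← hG₀]
        refine Algebra.adjoin_le fun g hg => ?_
        change g ∈ Subfield.closure ((K : Set Ω) ∪ G)
        refine Subfield.subset_closure (Or.inr ?_)
        simp [G, hg]
      exact div_mem (show a' ∈ Subfield.closure ((K : Set Ω) ∪ G) from hAT ha')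
        (show b' ∈ Subfield.closure ((K : Set Ω) ∪ G) from hAT hb')
  · intro x hx
    refine ⟨a x hx, ?_, b x hx, ?_, hab x hx⟩
    · simp only [G, Finset.mem_union, Finset.mem_image, Finset.mem_attach, true_and,
        Subtype.exists]
      exact Or.inl (Or.inr ⟨x, hx, rfl⟩)
    · simp only [G, Finset.mem_union, Finset.mem_image, Finset.mem_attach, true_and,
        Subtype.exists]
      exact Or.inr ⟨x, hx, rfl⟩

end Literature.AlgebraicGeometry.Resolution

end
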